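import Mathlib
import Literature.RepresentationTheory.FiniteGroups.IrreducibleCharacters

/-!
# Stub `stub_powerSep` for the line `Sketch` of `LevelGradedCohnUmans.GradedDesignFamily`

Direct powers `κ → G` of a finite group with the power test space
`J^{⊠κ} = span{h ↦ ∏ k, g k (h k) : g k ∈ J}`: bi-invariance of the test space and simultaneous
separation of the word family (pieces indexed by words `w : κ → ι`) are inherited from `(G, J)`.
The separator of a word target is the product of the coordinate separators.
-/

noncomputable section

set_option linter.dupNamespace false

open scoped BigOperators
open Literature.RepresentationTheory.FiniteGroups

namespace Summit.MatrixMultiplication.MatrixMultiplication.Theorems.GradedDesignFamily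

/-- Bi-invariance of the power test space `J^{⊠κ}`: translating a product generator
`h ↦ ∏ k, g k (h k)` on both sides by `a b : κ → G` gives the product generator of the translated
coordinate tests, so the span is stable under two-sided translation. -/
theorem powerSep_biInv {G : Type} [Group G] {κ : Type} [Fintype κ] (J : Submodule ℂ (G → ℂ))
    (hJ : ∀ f ∈ J, ∀ a b : G, (fun g : G => f (a * g * b)) ∈ J) (F : (κ → G) → ℂ)
    (hF : F ∈ Submodule.span ℂ {F : (κ → G) → ℂ | ∃ g : κ → (G → ℂ), (∀ k, g k ∈ J) ∧
        F = fun h => ∏ k, g k (h k)}) (a b : κ → G) :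
    (fun h : κ → G => F (a * h * b)) ∈
        Submodule.span ℂ {F : (κ → G) → ℂ | ∃ g : κ → (G → ℂ), (∀ k, g k ∈ J) ∧
          F = fun h => ∏ k, g k (h k)} := by
  induction hF using Submodule.span_induction with
  | mem F hF =>
    obtain ⟨g, hg, rfl⟩ := hF
    refine Submodule.subset_span ⟨fun k x => g k (a k * x * b k), fun k => hJ _ (hg k) _ _, ?_⟩
    funext h
    simp only [Pi.mul_apply]
  | zero => exact Submodule.zero_mem _
  | add F₁ F₂ _ _ h₁ h₂ => exact Submodule.add_mem _ h₁ h₂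
  | smul c F _ h => exact Submodule.smul_mem _ c h

/-- Simultaneous separation of the word family in the power group `κ → G`: for the target
`(x₀, z₀)` of the word `i`, the product of the coordinate separators (of pieces `i k` at targets
`(x₀ k, z₀ k)`) is a product generator of `J^{⊠κ}` reading the global indicator. -/
theorem powerSep_sep {G : Type} [Group G] {ι κ : Type} [Fintype κ] [DecidableEq κ]
    (J : Submodule ℂ (G → ℂ)) (X Y Z : ι → Finset G)
    (hsep : ∀ i : ι, ∀ x₀ ∈ X i, ∀ z₀ ∈ Z i, ∃ f ∈ J, ∀ a b : ι, ∀ x ∈ X a, ∀ y ∈ Y a, ∀ y' ∈ Y b,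
      ∀ z ∈ Z b, ((a = i ∧ b = i ∧ x = x₀ ∧ y = y' ∧ z = z₀) → f (x⁻¹ * y * y'⁻¹ * z) = 1) ∧
        (¬ (a = i ∧ b = i ∧ x = x₀ ∧ y = y' ∧ z = z₀) → f (x⁻¹ * y * y'⁻¹ * z) = 0))
    (i : κ → ι) (x₀ : κ → G) (hx₀ : x₀ ∈ Fintype.piFinset (fun k => X (i k))) (z₀ : κ → G)
    (hz₀ : z₀ ∈ Fintype.piFinset (fun k => Z (i k))) :
    ∃ F ∈ Submodule.span ℂ {F : (κ → G) → ℂ | ∃ g : κ → (G → ℂ), (∀ k, g k ∈ J) ∧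
        F = fun h => ∏ k, g k (h k)},
      ∀ a b : κ → ι, ∀ x ∈ Fintype.piFinset (fun k => X (a k)),
      ∀ y ∈ Fintype.piFinset (fun k => Y (a k)),
      ∀ y' ∈ Fintype.piFinset (fun k => Y (b k)), ∀ z ∈ Fintype.piFinset (fun k => Z (b k)),
        ((a = i ∧ b = i ∧ x = x₀ ∧ y = y' ∧ z = z₀) → F (x⁻¹ * y * y'⁻¹ * z) = 1) ∧
        (¬ (a = i ∧ b = i ∧ x = x₀ ∧ y = y' ∧ z = z₀) → F (x⁻¹ * y * y'⁻¹ * z) = 0) := by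
  rw [Fintype.mem_piFinset] at hx₀ hz₀
  choose f hfJ hf using fun k => hsep (i k) (x₀ k) (hx₀ k) (z₀ k) (hz₀ k)
  refine ⟨fun h => ∏ k, f k (h k), Submodule.subset_span ⟨f, hfJ, rfl⟩, ?_⟩
  intro a b x hx y hy y' hy' z hz
  rw [Fintype.mem_piFinset] at hx hy hy' hz
  have hloc : ∀ k, ((a k = i k ∧ b k = i k ∧ x k = x₀ k ∧ y k = y' k ∧ z k = z₀ k) →
      f k ((x⁻¹ * y * y'⁻¹ * z) k) = 1) ∧
      (¬ (a k = i k ∧ b k = i k ∧ x k = x₀ k ∧ y k = y' k ∧ z k = z₀ k) →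
      f k ((x⁻¹ * y * y'⁻¹ * z) k) = 0) := fun k => by
    simp only [Pi.mul_apply, Pi.inv_apply]
    exact hf k (a k) (b k) (x k) (hx k) (y k) (hy k) (y' k) (hy' k) (z k) (hz k)
  refine ⟨fun hglob => ?_, fun hne => ?_⟩
  · obtain ⟨ha, hb, hx', hyy', hz'⟩ := hglob
    exact Finset.prod_eq_one fun k _ =>
      (hloc k).1 ⟨congrFun ha k, congrFun hb k, congrFun hx' k, congrFun hyy' k, congrFun hz' k⟩
  · by_contra hprod
    apply hne
    have hall : ∀ k, a k = i k ∧ b k = i k ∧ x k = x₀ k ∧ y k = y' k ∧ z k = z₀ k := by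
      intro k
      by_contra hk
      exact hprod (Finset.prod_eq_zero (Finset.mem_univ k) ((hloc k).2 hk))
    exact ⟨funext fun k => (hall k).1, funext fun k => (hall k).2.1, funext fun k => (hall k).2.2.1,
      funext fun k => (hall k).2.2.2.1, funext fun k => (hall k).2.2.2.2⟩

/-- **Direct powers preserve bi-invariance and simultaneous separation** (the direct-power step of
the graded wreath lift, [cite: CohnKleinbergSzegedyUmans2005, Thm. 7.1]).  In the power group
`κ → G` with test space `J^{⊠κ} = span{h ↦ ∏ k, g k (h k) : g k ∈ J}` and pieces the words
`w : κ → ι` (`X_w = Π_k X (w k)`), the test space is bi-invariant and the word family is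
simultaneously `J^{⊠κ}`-separated, the separator being the product of coordinate separators. -/
theorem stub_powerSep {G : Type} [Group G] [DecidableEq G] {ι κ : Type} [Fintype ι] [DecidableEq ι]
    [Fintype κ] [DecidableEq κ] (J : Submodule ℂ (G → ℂ))
    (hJ : ∀ f ∈ J, ∀ a b : G, (fun g : G => f (a * g * b)) ∈ J) (X Y Z : ι → Finset G)
    (hsep : ∀ i : ι, ∀ x₀ ∈ X i, ∀ z₀ ∈ Z i, ∃ f ∈ J, ∀ a b : ι, ∀ x ∈ X a, ∀ y ∈ Y a, ∀ y' ∈ Y b,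
      ∀ z ∈ Z b, ((a = i ∧ b = i ∧ x = x₀ ∧ y = y' ∧ z = z₀) → f (x⁻¹ * y * y'⁻¹ * z) = 1) ∧
        (¬ (a = i ∧ b = i ∧ x = x₀ ∧ y = y' ∧ z = z₀) → f (x⁻¹ * y * y'⁻¹ * z) = 0)) :
    (∀ F ∈ Submodule.span ℂ {F : (κ → G) → ℂ | ∃ g : κ → (G → ℂ), (∀ k, g k ∈ J) ∧
        F = fun h => ∏ k, g k (h k)}, ∀ a b : κ → G, (fun h : κ → G => F (a * h * b)) ∈
        Submodule.span ℂ {F : (κ → G) → ℂ | ∃ g : κ → (G → ℂ), (∀ k, g k ∈ J) ∧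
          F = fun h => ∏ k, g k (h k)}) ∧
    (∀ i : κ → ι, ∀ x₀ ∈ Fintype.piFinset (fun k => X (i k)), ∀ z₀ ∈ Fintype.piFinset (fun k => Z (i k)),
      ∃ F ∈ Submodule.span ℂ {F : (κ → G) → ℂ | ∃ g : κ → (G → ℂ), (∀ k, g k ∈ J) ∧
        F = fun h => ∏ k, g k (h k)},
      ∀ a b : κ → ι, ∀ x ∈ Fintype.piFinset (fun k => X (a k)), ∀ y ∈ Fintype.piFinset (fun k => Y (a k)),
      ∀ y' ∈ Fintype.piFinset (fun k => Y (b k)), ∀ z ∈ Fintype.piFinset (fun k => Z (b k)),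
        ((a = i ∧ b = i ∧ x = x₀ ∧ y = y' ∧ z = z₀) → F (x⁻¹ * y * y'⁻¹ * z) = 1) ∧
        (¬ (a = i ∧ b = i ∧ x = x₀ ∧ y = y' ∧ z = z₀) → F (x⁻¹ * y * y'⁻¹ * z) = 0)) :=
  ⟨fun F hF a b => powerSep_biInv J hJ F hF a b,
    fun i x₀ hx₀ z₀ hz₀ => powerSep_sep J X Y Z hsep i x₀ hx₀ z₀ hz₀⟩

end Summit.MatrixMultiplication.MatrixMultiplication.Theorems.GradedDesignFamily

end
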